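import Literature.NumberTheory.Automorphic.DoubledUnitaryRankOneReductionDiag
import Literature.NumberTheory.Automorphic.AdelicUnitaryGroup
import HarnessLib

/-!
# Crux `HLiu418`, line LD1, organ (P) — piece (P♭-r): AN ABSTRACT FRAME TRANSPORT WITH THE MATRIX FORMULA `k ↦ g_𝔸⁻¹ k g_𝔸` CARRIES RATIONAL
# POINTS TO RATIONAL POINTS (no frame identity needed)

Cell `hodgecm-mathlib`, FLOOR 0, line LD1 (socket 27458 `Cruxes/HLiu418/Lines/F0_AlbCm.lean`, stub `stub_S1_facts`); skeleton v5
`F0/P6/LD/LD1-plan/g0/StubS1facts.inhouse.skeleton.v5.lean` (22e0f4f496aabf7d), organ (P) `stub_thetaCharPinned : ThetaCharPinned₂`; seat LD1-p02 (g0);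
`--supports stmt-HodgeConjecture-24832` (helper).  THEOREMS ONLY — no definition, no instance, no notation, no `sorry`.

The organs of the LD1∕LD2 skeletons quantify over an ABSTRACT homomorphism `ιA : U(H)(𝔸_{L⁺}) →* U(diag dV)(𝔸_{L⁺})` pinned only by its matrix formula
`↑(ιA k) = g_𝔸⁻¹ · k · g_𝔸` (`g ∈ GL_N(L)` the letter's frame).  The left-invariance input `hιArat` of ★-candidate
`Theorems/F0P6LD1ThetaCharacterPin` («`ιA (toAdelic γ) ∈ range toAdelic` for every rational `γ`») follows from that formula ALONE: `g_𝔸⁻¹ γ_𝔸 g_𝔸 = (g⁻¹ γ g)_𝔸`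
is the adelic image of a RATIONAL matrix, and an element of `U(diag dV)(𝔸_{L⁺})` with rational matrix is a rational point (★
`DoubledUnitary.RankOneReduction.mem_range_toAdelic_iff`: injectivity of `L → 𝔸_L`).  No use is made of the frame identity `ᵗḡ (tH) g = diag dV`
(scaled or not), so the lemma serves the SCALED frame of the letters verbatim.
HONEST LABEL: HC_CM is proved only modulo the 7 printed citations (2 remaining: hLiu418 = stmt-HodgeConjecture-24832, h413 = stmt-HodgeConjecture-24833)
until rung 0 closes; this file discharges none of them.

## References
* [Mok2014] C. P. Mok, Mem. AMS 235 (2015), §1 Notation p. 5 (the groups `U(J)`, rational and adelic points).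
* [PlatonovRapinchuk1994] V. Platonov, A. Rapinchuk, *Algebraic Groups and Number Theory* (1994), §5.1 (adelic points of linear groups).
-/

set_option autoImplicit false
-- the mandated namespace has the single-problem summit's repeated segment (`HodgeConjecture.HodgeConjecture`)
set_option linter.dupNamespace false

noncomputable section

open NumberField IsDedekindDomain
open scoped Matrix
open Literature.NumberTheory.Automorphic Literature.NumberTheory.Automorphic.UnitaryGroup

namespace Summit.HodgeConjecture.HodgeConjecture.Cruxes.HLiu418.F0P6LD1TransportRational

variable (L : Type) [Field L] [NumberField L] [IsCMField L] (N : ℕ) (H : Matrix (Fin N) (Fin N) L) (dV : Fin N → L)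
  (g : GL (Fin N) L)
  (ιA : (adelicGroupData (↥(maximalRealSubfield L)) L (IsCMField.complexConj L) N H).Adelic →*
    ↥(UnitaryGroup.adelic (↥(maximalRealSubfield L)) L (IsCMField.complexConj L) N (Matrix.diagonal dV)))
  (hιA : ∀ k, ((ιA k : ↥(UnitaryGroup.adelic (↥(maximalRealSubfield L)) L (IsCMField.complexConj L) N (Matrix.diagonal dV))) :
      GL (Fin N) (AdeleRing (𝓞 L) L)) =
    (toAdeleGL L g)⁻¹ * adelicVal (↥(maximalRealSubfield L)) L (IsCMField.complexConj L) N H k * toAdeleGL L g)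

include hιA

/-- **The matrix of `ιA(γ_𝔸)` is the adelic image of the rational matrix `g⁻¹ γ g`.** [cite: Mok2014, §1 Notation p. 5] -/
theorem coe_transport_toAdelic (γ : (adelicGroupData (↥(maximalRealSubfield L)) L (IsCMField.complexConj L) N H).Rational) :
    ((ιA ((adelicGroupData (↥(maximalRealSubfield L)) L (IsCMField.complexConj L) N H).toAdelic γ) :
        ↥(UnitaryGroup.adelic (↥(maximalRealSubfield L)) L (IsCMField.complexConj L) N (Matrix.diagonal dV))) :
          GL (Fin N) (AdeleRing (𝓞 L) L)) =
      toAdeleGL L (g⁻¹ * ((show ↥(UnitaryGroup.rational (↥(maximalRealSubfield L)) L (IsCMField.complexConj L) N H) from γ) :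
        GL (Fin N) L) * g) := by
  rw [hιA, map_mul, map_mul, map_inv]
  rfl

/-- **(P♭-r) An abstract frame transport carries rational points to rational points**: `ιA (γ_𝔸) ∈ U(diag dV)(L⁺)` for every `γ ∈ U(H)(L⁺)` — the
left-invariance input `hιArat` of ★-candidate `F0P6LD1ThetaCharacterPin` for the skeletons' abstract `ιA`. [cite: Mok2014, §1 Notation p. 5]
[cite: PlatonovRapinchuk1994, §5.1] -/
theorem transport_toAdelic_mem_range (γ : (adelicGroupData (↥(maximalRealSubfield L)) L (IsCMField.complexConj L) N H).Rational) :
    ιA ((adelicGroupData (↥(maximalRealSubfield L)) L (IsCMField.complexConj L) N H).toAdelic γ) ∈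
      (UnitaryGroup.toAdelic (↥(maximalRealSubfield L)) L (IsCMField.complexConj L) N (Matrix.diagonal dV)).range :=
  (DoubledUnitary.RankOneReduction.mem_range_toAdelic_iff (↥(maximalRealSubfield L)) L (IsCMField.complexConj L) (Matrix.diagonal dV) _).2
    ⟨g⁻¹ * ((show ↥(UnitaryGroup.rational (↥(maximalRealSubfield L)) L (IsCMField.complexConj L) N H) from γ) : GL (Fin N) L) * g,
      (coe_transport_toAdelic L N H dV g ιA hιA γ).symm⟩

end Summit.HodgeConjecture.HodgeConjecture.Cruxes.HLiu418.F0P6LD1TransportRational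

end
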